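import Literature.Probability.Moments.DeflatedTraceEstimator
import HarnessLib

/-!
# The Hutch++ tail bound: deflating the `k` largest eigenvalues of a positive semidefinite matrix
# leaves `‖A − A_k‖_F² ≤ tr(A)²/k`, hence Gaussian single-probe variance `≤ 2 tr(A)²/k`

Topic `Probability/Moments`; sequel of `DeflatedTraceEstimator.lean` (exact eigenvector deflation
`A_R = A π_R` of the stochastic trace estimator: `tr A = tr A_R + Σ_j λ_{e j}`,
`‖A_R‖_F² = Σ_{l ∉ deflated} λ_l²`, Gaussian variance `Var(zᵀA_R z) = 2‖A_R‖_F²` — Gambhir–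
Stathopoulos–Orginos 2017) and `StochasticTraceEstimator.lean` (Avron–Toledo Lemma 5.1,
`Var(zᵀAz) = 2‖A‖_F²`).  Here the DETERMINISTIC lemma behind Meyer–Musco–Musco–Woodruff's Hutch++
is proved: if the deflated eigenvalues dominate the remaining ones (the `k` largest of a PSD
matrix), the residual Frobenius mass is at most `tr(A)²/k`, so the deflated estimator's Gaussian
variance is at most `2 tr(A)²/k` — RELATIVE accuracy `ε` from `O(1/(kε²))` instead of `O(1/ε²)`
probes.  PUBLISHED RESULT with the printed proof; no definition and no named fact
(`def … : Prop`) is introduced (D-0026).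

HONEST FRAMING: exact (Metropolis-corrected) sampling algorithms for lattice gauge theory; figures
of merit are autocorrelation/cost numbers at stated couplings and volumes; no continuum-physics claim.

## Source (read on the materialised text) and what is taken

R. A. Meyer, C. Musco, C. Musco, D. P. Woodruff, *Hutch++: Optimal Stochastic Trace Estimation*,
SOSA 2021, 142–155 = arXiv:2010.09649 [MeyerMuscoMuscoWoodruff2021] (held text
`paper:arxiv-2010.09649`, chunks p0005–p0006): §2 "We let `λ = λ(A)` be a vector containing `A`'s
eigenvalues in descending order … `tr(A) = ‖λ‖₁` and `‖A‖_F = ‖λ‖₂`. We let `A_k = argmin_{rank k}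
‖A − B‖_F` denote the optimal `k`-rank approximation … For a PSD matrix `A`, `A_k = V_kΛ_kV_kᵀ`";
§3 "for a PSD matrix with eigenvalues `λ`, `‖A‖_F ≤ tr(A)` … Hutch++ simply eliminates this
possibility by approximately projecting off `A`'s large eigenvalues … **Lemma 3.** Let `A_k` be the
best rank-`k` approximation to PSD matrix `A`. Then `‖A − A_k‖_F ≤ (1/√k) tr(A)`. *Proof.* We have
`λ_{k+1} ≤ (1/k) Σ_{i=1}^k λ_i ≤ (1/k) tr(A)`, so:
`‖A − A_k‖_F² = Σ_{i=k+1}^d λ_i² ≤ λ_{k+1} Σ_{i=k+1}^d λ_i ≤ (1/k) tr(A) Σ_{i=k+1}^d λ_i ≤ (1/k) tr(A)²`."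
(Theorems 1 and 4 — the randomised sketch `Q = orth(AS)`, `‖A − QQᵀA‖_F ≤ O(‖A − A_k‖_F)`, and
the `(1 ± ε)` guarantee with `O(1/ε)` queries at probability `1 − δ` via the Hanson–Wright-type
Lemma 2 — are NOT formalised: they need the projection-cost-preserving-sketch bounds of
[CohenElderMusco:2015]; this file is the exact-deflation case `Q = V_k`, where Lemma 3 alone
controls the variance.)

## What is formalised (real symmetric `A : Matrix ι ι ℝ`; `e : k → ι` injective, the deflated
## eigen-indices; "top": `λ_l ≤ λ_{e j}` for every non-deflated `l` and deflated `j`)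

* `sum_sq_notMem_le` — the counting lemma of the printed proof for a nonnegative family `w`:
  if `w_l ≤ w_j` for all `l ∉ E`, `j ∈ E`, `#E = k ≥ 1`, then `Σ_{l∉E} w_l² ≤ (Σ_l w_l)²/k`.
* **`sum_sq_tail_eigenvalues_le`** — LEMMA 3: for `A` positive semidefinite and a top-`k`
  deflation set, `Σ_{l ∉ deflated} λ_l² ≤ tr(A)²/k`; with `DeflatedTrace.sum_sq_deflated` this is
  **`frobeniusSq_deflated_le`**: `‖A π_R‖_F² = Σ_{ij} (Aπ_R)_ij² ≤ tr(A)²/k`.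
* `sum_sq_eigenvalues_le_trace_sq` — "`‖A‖_F ≤ tr(A)`" for PSD `A` (squared), and
  `variance_gaussian_le_trace_sq` — Hutchinson's Gaussian single-probe variance `≤ 2 tr(A)²`.
* **`variance_gaussian_deflated_le_trace_sq_div`** — the Hutch++ mechanism with exact top-`k`
  deflation: `Var(zᵀ A_R z) ≤ 2 tr(A)²/k` (Gaussian probe), against `2‖A‖_F² ≤ 2 tr(A)²` undeflated.

Context (cell pub-lqcd, HOME/R2-SCOPE.md §3 E6/E9: deflated Hutchinson estimates of `tr f(D†D)`
(`f = (·)⁻¹`, `log`) — the low modes of the Dirac operator are the large eigenvalues of `f(D†D)`;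
this file quantifies the worst-case variance left after deflating `k` of them, in units of the
trace itself).  No continuum-physics claim.
-/

noncomputable section

open scoped Matrix
open Finset MeasureTheory ProbabilityTheory

namespace Literature.Probability.Moments

namespace DeflatedTrace

open _root_.Matrix Literature.LinearAlgebra.Matrix.Deflation Literature.Analysis.Matrix
  Literature.Analysis.Matrix.ConjugateGradient Literature.Probability.Moments.StochasticTrace

variable {ι k : Type*} [Fintype ι] [Fintype k] [DecidableEq ι] [DecidableEq k]

/-! ### The counting lemma -/

omit [Fintype k] [DecidableEq k] in
/-- The printed proof of Lemma 3 for a nonnegative family: if the members outside `E` are dominated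
by every member of `E` (`#E = k ≥ 1`), then `Σ_{l∉E} w_l² ≤ (Σ_l w_l)·(Σ_{l∉E} w_l)/k ≤ (Σ_l w_l)²/k`
("`λ_{k+1} ≤ (1/k)Σ_{i≤k}λ_i ≤ (1/k) tr(A)`, so `Σ_{i>k}λ_i² ≤ λ_{k+1}Σ_{i>k}λ_i ≤ (1/k) tr(A)²`").
[cite: MeyerMuscoMuscoWoodruff2021, §3 Lemma 3 (proof)] -/
theorem sum_sq_notMem_le {w : ι → ℝ} (hw : ∀ l, 0 ≤ w l) {E : Finset ι} (hE : E.Nonempty)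
    (htop : ∀ l ∉ E, ∀ j ∈ E, w l ≤ w j) :
    ∑ l ∈ univ.filter (· ∉ E), w l ^ 2 ≤ (∑ l, w l) ^ 2 / E.card := by
  have hk : (0 : ℝ) < E.card := Nat.cast_pos.mpr hE.card_pos
  -- every non-deflated weight is at most the average of the deflated ones, hence `≤ (Σ w)/k`
  have hbound : ∀ l ∉ E, w l ≤ (∑ j, w j) / E.card := by
    intro l hl
    rw [le_div_iff₀ hk]
    calc w l * E.card = ∑ _j ∈ E, w l := by rw [sum_const, nsmul_eq_mul, mul_comm]
      _ ≤ ∑ j ∈ E, w j := sum_le_sum fun j hj => htop l hl j hj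
      _ ≤ ∑ j, w j := sum_le_univ_sum_of_nonneg hw
  have htail : ∑ l ∈ univ.filter (· ∉ E), w l ≤ ∑ l, w l :=
    sum_le_univ_sum_of_nonneg hw
  have htot : 0 ≤ ∑ l, w l := sum_nonneg fun l _ => hw l
  calc ∑ l ∈ univ.filter (· ∉ E), w l ^ 2
      ≤ ∑ l ∈ univ.filter (· ∉ E), w l * ((∑ j, w j) / E.card) := by
        refine sum_le_sum fun l hl => ?_
        rw [sq]
        exact mul_le_mul_of_nonneg_left (hbound l (mem_filter.mp hl).2) (hw l)
    _ = (∑ l ∈ univ.filter (· ∉ E), w l) * ((∑ j, w j) / E.card) := by rw [sum_mul]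
    _ ≤ (∑ l, w l) * ((∑ j, w j) / E.card) :=
        mul_le_mul_of_nonneg_right htail (div_nonneg htot hk.le)
    _ = (∑ l, w l) ^ 2 / E.card := by rw [sq, mul_div_assoc]

/-! ### Lemma 3 in the tree's deflation vocabulary -/

variable {A : Matrix ι ι ℝ}

omit [DecidableEq k] in
/-- The `Set.range e`-indexed sum of `DeflatedTraceEstimator` as a sum over the complement of the
finset `univ.image e`. [folklore] -/
private theorem sum_ite_range_eq_sum_filter (e : k → ι) (f : ι → ℝ) :
    ∑ l, (if l ∈ Set.range e then 0 else f l) ^ 2 =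
      ∑ l ∈ univ.filter (· ∉ univ.image e), f l ^ 2 := by
  classical
  rw [sum_filter]
  refine sum_congr rfl fun l _ => ?_
  by_cases hl : l ∈ Set.range e
  · have : l ∈ univ.image e := by
      obtain ⟨j, rfl⟩ := hl; exact mem_image_of_mem e (mem_univ j)
    simp [hl, this]
  · have : l ∉ univ.image e := fun h => by
      obtain ⟨j, -, rfl⟩ := mem_image.mp h; exact hl ⟨j, rfl⟩
    simp [hl, this]

omit [DecidableEq k] in
/-- **Lemma 3 (Meyer–Musco–Musco–Woodruff)**: for `A` positive semidefinite and a deflation set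
`e : k → ι` (injective, `k` nonempty) carrying the LARGEST eigenvalues — `λ_l ≤ λ_{e j}` for every
non-deflated `l` and every `j` — the remaining squared eigenvalue mass is at most `tr(A)²/k`:
`Σ_{l ∉ deflated} λ_l² ≤ tr(A)²/|k|` ("`‖A − A_k‖_F ≤ tr(A)/√k`").
[cite: MeyerMuscoMuscoWoodruff2021, §3 Lemma 3] -/
theorem sum_sq_tail_eigenvalues_le (hA : A.PosSemidef) [Nonempty k] {e : k → ι}
    (he : Function.Injective e)
    (htop : ∀ l ∉ Set.range e, ∀ j, hA.1.eigenvalues l ≤ hA.1.eigenvalues (e j)) :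
    ∑ l, (if l ∈ Set.range e then 0 else hA.1.eigenvalues l) ^ 2 ≤
      A.trace ^ 2 / Fintype.card k := by
  rw [sum_ite_range_eq_sum_filter, hA.1.trace_eq_sum_eigenvalues]
  simp only [RCLike.ofReal_real_eq_id, id_eq]
  have hcard : (univ.image e).card = Fintype.card k := by
    rw [card_image_of_injective _ he, card_univ]
  rw [← hcard]
  refine sum_sq_notMem_le hA.eigenvalues_nonneg ?_ ?_
  · exact (univ_nonempty.image e)
  · intro l hl j hj
    obtain ⟨j', -, rfl⟩ := mem_image.mp hj
    exact htop l (fun ⟨i, hi⟩ => hl (hi ▸ mem_image_of_mem e (mem_univ i))) j'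

/-- **`‖A − A_k‖_F² ≤ tr(A)²/k` for the tree's deflated matrix**: with exact top-`k` deflation
(deflated eigenvalues non-zero, as `piR` requires) `Σ_{ij} (A π_R)_ij² ≤ tr(A)²/|k|`.
[cite: MeyerMuscoMuscoWoodruff2021, §3 Lemma 3] [cite: GambhirStathopoulosOrginos2017, §2
eq. (2.7)] -/
theorem frobeniusSq_deflated_le (hA : A.PosSemidef) [Nonempty k] {e : k → ι}
    (he : Function.Injective e) (hne : ∀ j, hA.1.eigenvalues (e j) ≠ 0)
    (htop : ∀ l ∉ Set.range e, ∀ j, hA.1.eigenvalues l ≤ hA.1.eigenvalues (e j)) :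
    ∑ i, ∑ j, (A * piR A (eigMatrix hA.1 e) (eigMatrix hA.1 e)ᵀ) i j ^ 2 ≤
      A.trace ^ 2 / Fintype.card k := by
  rw [sum_sq_deflated hA.1 he hne]
  exact sum_sq_tail_eigenvalues_le hA he htop

/-! ### Consequences for the Gaussian trace estimator -/

/-- "For a PSD matrix with eigenvalues `λ`, `‖A‖_F ≤ tr(A)`" (squared: `Σ_l λ_l² ≤ (Σ_l λ_l)²`).
[cite: MeyerMuscoMuscoWoodruff2021, §3 (first paragraph)] -/
theorem sum_sq_eigenvalues_le_trace_sq (hA : A.PosSemidef) :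
    ∑ l, hA.1.eigenvalues l ^ 2 ≤ A.trace ^ 2 := by
  rw [hA.1.trace_eq_sum_eigenvalues]
  simp only [RCLike.ofReal_real_eq_id, id_eq, sq]
  rw [sum_mul_sum]
  refine sum_le_sum fun i _ => ?_
  rw [← sum_singleton (fun j => hA.1.eigenvalues i * hA.1.eigenvalues j) i]
  exact sum_le_univ_sum_of_nonneg fun j => mul_nonneg (hA.eigenvalues_nonneg i)
    (hA.eigenvalues_nonneg j)

/-- Hutchinson's Gaussian single-probe variance for a PSD matrix is at most `2 tr(A)²` — so
relative accuracy `ε` needs `O(1/ε²)` probes. [cite: MeyerMuscoMuscoWoodruff2021, §3 (first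
paragraph, with Lemma 2)] [cite: AvronToledo2011, Lemma 5.1] -/
theorem variance_gaussian_le_trace_sq (hA : A.PosSemidef) :
    ∫ z, (traceEst A z - A.trace) ^ 2 ∂(Measure.pi fun _ : ι => gaussianReal 0 1) ≤
      2 * A.trace ^ 2 := by
  rw [variance_traceEst_gaussian_eq_sum_eigenvalues hA.1]
  exact mul_le_mul_of_nonneg_left (sum_sq_eigenvalues_le_trace_sq hA) zero_le_two

/-- **The Hutch++ variance mechanism with exact top-`k` deflation**: for `A` positive semidefinite,
deflating `k` eigenvectors whose eigenvalues dominate the rest leaves a Gaussian single-probe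
variance `Var(zᵀ A_R z) = 2‖A_R‖_F² ≤ 2 tr(A)²/|k|` for the estimator of `tr A_R = tr A − Σ_j λ_{e j}`.
[cite: MeyerMuscoMuscoWoodruff2021, §3 Lemma 3, with §1 after Theorem 1 ("a natural variance
reduced version of Hutchinson's estimator … the variance when estimating this term is much lower")] [cite: GambhirStathopoulosOrginos2017, §1–§2 eq. (2.7)] -/
theorem variance_gaussian_deflated_le_trace_sq_div (hA : A.PosSemidef) [Nonempty k] {e : k → ι}
    (he : Function.Injective e) (hne : ∀ j, hA.1.eigenvalues (e j) ≠ 0)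
    (htop : ∀ l ∉ Set.range e, ∀ j, hA.1.eigenvalues l ≤ hA.1.eigenvalues (e j)) :
    ∫ z, (traceEst (A * piR A (eigMatrix hA.1 e) (eigMatrix hA.1 e)ᵀ) z -
        (A * piR A (eigMatrix hA.1 e) (eigMatrix hA.1 e)ᵀ).trace) ^ 2
          ∂(Measure.pi fun _ : ι => gaussianReal 0 1) ≤
      2 * (A.trace ^ 2 / Fintype.card k) := by
  rw [variance_traceEst_gaussian_deflated hA.1 he hne]
  exact mul_le_mul_of_nonneg_left (sum_sq_tail_eigenvalues_le hA he htop) zero_le_two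

end DeflatedTrace

end Literature.Probability.Moments
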